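import Literature.NumberTheory.Transcendental.KZLogCalculusProofs
import Literature.NumberTheory.Transcendental.KZMellinFibres
import Literature.NumberTheory.Transcendental.KZDominatedFamilyRelations
import Summits.KontsevichZagierPeriods.KontsevichZagierPeriods.Theorems.HurwitzMicroSectorsNormalFormPrincipleLevelOneExistsRep

/-!
# `NormalFormPrinciple` (stmt-KontsevichZagierPeriods-3869), line `SketchIdeator1` — leaf `stub_boxRigidity`,
# dimension two off the product type (`FiveZetaTwoOffProduct`): the affine unfolding (rule 2)

Registered sub-goal `boxQuad_sub_logMonomial` of the layer `FiveZetaTwoOffProduct` (lead file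
`…M2`). Let `σ = {0 < x < 1} ⊆ ℝ¹`. For any representation `T` on the band-box
`{0 < x < 1, 0 ≤ y ≤ 1} = KZlog.band σ 0 1` with integrand `1/(1 + x² + x y)` there, and any
representation `W` on the band `{0 < x < 1, 1 ≤ s ≤ (1 + x + x²)/(1 + x²)}` with integrand
`(1/x)/s` there (the unfolded "log monomial" `M(1/x, (1 + x + x²)/(1 + x²))`), the difference
`[T] − [W]` is a relation: it is ONE instance of Kontsevich–Zagier's rule (2), the affine
substitution `s = 1 + x y/(1 + x²)` along the last coordinate over the open base `σ`
(`KZ.of_sub_of_mem_relations_of_affine` with `α = 1`, `β = x/(1 + x²) > 0`, Jacobian `β`), since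
`(1/x)/(1 + x y/(1 + x²)) · x/(1 + x²) = 1/(1 + x² + x y)` and the edges `0 ≤ y ≤ 1` go to
`1 ≤ s ≤ 1 + x/(1 + x²) = (1 + x + x²)/(1 + x²)`.

References: M. Kontsevich, D. Zagier, *Periods* (2001), §1.2, rule (2). No new definitions.
-/

noncomputable section

open MeasureTheory Set
open Literature.NumberTheory.Transcendental Literature.NumberTheory.Transcendental.KZ
open Literature.ModelTheory.ExponentialFields (IsSemialgebraic)

namespace Summit.KontsevichZagierPeriods.HurwitzMicroSectors.NormalFormPrinciple.PiBox.M2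

/-- The pointwise identity behind the affine unfolding `s = 1 + x y/(1 + x²)`:
`1/(1 + x² + x t) = (1/x)/(1 + (x/(1 + x²)) t) · x/(1 + x²)` for `x > 0`, `t ≥ 0`. [folklore] -/
theorem boxQuad_affine_identity {x t : ℝ} (hx : 0 < x) (ht : 0 ≤ t) :
    1 / (1 + x ^ 2 + x * t) = 1 / x / (1 + x / (1 + x ^ 2) * t) * (x / (1 + x ^ 2)) := by
  have h1 : (1 + x ^ 2 : ℝ) ≠ 0 := by positivity
  have h2 : (1 + x ^ 2 + x * t : ℝ) ≠ 0 := by positivity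
  have h3 : 1 + x / (1 + x ^ 2) * t = (1 + x ^ 2 + x * t) / (1 + x ^ 2) := by
    field_simp
  rw [h3]
  field_simp

/-- The upper edge of the unfolded band: `(1 + x + x²)/(1 + x²) = 1 + (x/(1 + x²)) · 1`.
[folklore] -/
theorem boxQuad_upper_edge (x : ℝ) :
    (1 + x + x ^ 2) / (1 + x ^ 2) = 1 + x / (1 + x ^ 2) * 1 := by
  have h1 : (1 + x ^ 2 : ℝ) ≠ 0 := by positivity
  field_simp
  ring

/-- **The affine unfolding** (Kontsevich–Zagier rule 2; registered sub-goal A of the layer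
`FiveZetaTwoOffProduct` of `stub_boxRigidity` in dimension two). For any representation `T` on the
band-box `{0 < x < 1, 0 ≤ y ≤ 1}` with integrand `1/(1 + x² + x y)` there and any representation
`W` on the band `{0 < x < 1, 1 ≤ s ≤ (1 + x + x²)/(1 + x²)}` with integrand `(1/x)/s` there,
`[T] − [W] ∈ relations`: the substitution `s = 1 + x y/(1 + x²)` along the last coordinate over the
open base `(0,1)` (`KZ.of_sub_of_mem_relations_of_affine`, `α = 1`, `β = x/(1 + x²)`, Jacobian
`β`) carries the band-box onto the band, and `(1/x)/(1 + x y/(1 + x²)) · x/(1 + x²) =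
1/(1 + x² + x y)`. [cite: KontsevichZagier2001, §1.2 rule (2)] -/
theorem boxQuad_sub_logMonomial (T W : IntegralRep 2)
    (hTd : T.domain = KZlog.band {y : Fin 1 → ℝ | 0 < y 0 ∧ y 0 < 1} (fun _ => (0:ℝ))
      (fun _ => (1:ℝ)))
    (hTi : EqOn T.integrand (fun z => 1 / (1 + z 0 ^ 2 + z 0 * z 1)) T.domain)
    (hWd : W.domain = KZlog.band {y : Fin 1 → ℝ | 0 < y 0 ∧ y 0 < 1} (fun _ => (1:ℝ))
      (fun y => (1 + y 0 + y 0 ^ 2) / (1 + y 0 ^ 2)))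
    (hWi : EqOn W.integrand (fun z => (1 / z 0) / z 1) W.domain) :
    of T - of W ∈ relations := by
  -- the open base `G = (0,1) ⊆ ℝ¹`
  have hG : IsSemialgebraic ℚ {y : Fin 1 → ℝ | 0 < y 0 ∧ y 0 < 1} :=
    isSemialgebraic_unitInterval_fin_one
  have hGo : IsOpen {y : Fin 1 → ℝ | 0 < y 0 ∧ y 0 < 1} :=
    isOpen_Ioo.preimage (continuous_apply 0)
  -- the coefficients `α = 1`, `β = x/(1 + x²)` of the substitution
  have hα : IsSemialgebraicFunOn ℚ {y : Fin 1 → ℝ | 0 < y 0 ∧ y 0 < 1} (fun _ => (1:ℝ)) := by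
    simpa using isSemialgebraicFunOn_ratCast hG 1
  have hβ : IsSemialgebraicFunOn ℚ {y : Fin 1 → ℝ | 0 < y 0 ∧ y 0 < 1}
      (fun y => y 0 / (1 + y 0 ^ 2)) := by
    refine (isSemialgebraicFunOn_aeval_div_aeval hG (MvPolynomial.X 0) (1 + MvPolynomial.X 0 ^ 2)
      fun x _ => ?_).congr fun x _ => by simp
    simp only [map_add, map_one, map_pow, MvPolynomial.aeval_X]
    positivity
  have hβd : DifferentiableOn ℝ (fun y : Fin 1 → ℝ => y 0 / (1 + y 0 ^ 2))
      {y : Fin 1 → ℝ | 0 < y 0 ∧ y 0 < 1} := by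
    intro y _
    fun_prop (disch := positivity)
  have hβpos : ∀ y ∈ {y : Fin 1 → ℝ | 0 < y 0 ∧ y 0 < 1}, 0 < y 0 / (1 + y 0 ^ 2) :=
    fun y hy => div_pos hy.1 (by positivity)
  -- the integrands match along the substitution `s = 1 + (x/(1 + x²)) y`
  have key : ∀ z ∈ T.domain, T.integrand z =
      W.integrand (Fin.snoc (Fin.init z)
        (1 + Fin.init z 0 / (1 + Fin.init z 0 ^ 2) * z (Fin.last 1))) *
        (Fin.init z 0 / (1 + Fin.init z 0 ^ 2)) := by
    intro z hz
    have hz' := hz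
    rw [hTd] at hz'
    obtain ⟨hzG, h0, h1⟩ := KZlog.mem_band.1 hz'
    have hx : 0 < Fin.init z 0 ∧ Fin.init z 0 < 1 := hzG
    have h0' : 0 ≤ z (Fin.last 1) := h0
    have h1' : z (Fin.last 1) ≤ 1 := h1
    have hb : 0 ≤ Fin.init z 0 / (1 + Fin.init z 0 ^ 2) := (hβpos _ hzG).le
    have hw : (Fin.snoc (Fin.init z) (1 + Fin.init z 0 / (1 + Fin.init z 0 ^ 2) * z (Fin.last 1)) :
        Fin 2 → ℝ) ∈ W.domain := by
      rw [hWd]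
      refine KZlog.mem_band.2 ?_
      rw [Fin.init_snoc, Fin.snoc_last]
      refine ⟨hzG, ?_, ?_⟩
      · show (1:ℝ) ≤ 1 + Fin.init z 0 / (1 + Fin.init z 0 ^ 2) * z (Fin.last 1)
        nlinarith [mul_nonneg hb h0']
      · show 1 + Fin.init z 0 / (1 + Fin.init z 0 ^ 2) * z (Fin.last 1) ≤
          (1 + Fin.init z 0 + Fin.init z 0 ^ 2) / (1 + Fin.init z 0 ^ 2)
        rw [boxQuad_upper_edge]
        nlinarith [mul_le_mul_of_nonneg_left h1' hb]
    rw [hTi hz, hWi hw]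
    show 1 / (1 + z 0 ^ 2 + z 0 * z 1) =
      1 / z 0 / (1 + z 0 / (1 + z 0 ^ 2) * z 1) * (z 0 / (1 + z 0 ^ 2))
    exact boxQuad_affine_identity hx.1 h0'
  exact of_sub_of_mem_relations_of_affine (m := 1) hGo (α := fun _ => (1:ℝ))
    (β := fun y => y 0 / (1 + y 0 ^ 2)) (a := fun _ => (0:ℝ)) (b := fun _ => (1:ℝ))
    (a' := fun _ => (1:ℝ)) (b' := fun y => (1 + y 0 + y 0 ^ 2) / (1 + y 0 ^ 2)) hα hβ
    (differentiableOn_const 1) hβd hβpos T W hTd hWd (fun y _ => by ring)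
    (fun y _ => boxQuad_upper_edge (y 0)) key

end Summit.KontsevichZagierPeriods.HurwitzMicroSectors.NormalFormPrinciple.PiBox.M2
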